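import Summits.Ventures.Crystal3D.Theorems.StickyWulffConstantPolycrystalWulffBoundFreeEnergyExterior

/-!
# `PolycrystalWulffBound`: changing the bodies of some grains costs at most `(R − r)·(their free area)`

Route `StickyWulffConstant` of the venture `Summits/Ventures/Crystal3D`, crux `PolycrystalWulffBound`
(item `stmt-Ventures-19482`), second prover lane (poly-p2, gen 4).  The free-energy half of the
RECOLOURING MOVE of the middle-band programme (HOME/poly-p2/MIDDLE-BAND-g4.md §1, the induction step
of CJ-P for every number of classes): for pairwise disjoint polyhedral grains `G_f` of finite volume
and two families of origin-symmetric compact convex bodies with `B̄(0, r) ⊆ K_f` and `K'_f ⊆ B̄(0, R)`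
that differ only on a set `T` of grains,

  `Fr(K') − (R − r) · Σ_{f ∈ T} Y_f ≤ Fr(K)`,   `Y_f = per_{B̄(0,1)}(G f) − Σ_{g ≠ f} ι_{B̄(0,1)}(G f, G g)`

(`freeEnergy_bodyChange_ge`; `Y_f` is the Euclidean area of the FREE boundary of grain `f`).  With
the crux's Wulff bodies (`r = √3`, `R = √5`) and `K'` = «the grains of some classes re-labelled with
another class's body» this is `Fr ≥ Fr(recoloured) − (√5 − √3)·Y_S`.  Ingredients: each grain's free
energy is half its body's cross sum with the exterior cells (`exists_exterior_crossSums`), cross sums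
are monotone in the body (`crossSum_mono`), and the ball cross sums are `ρ` times the Euclidean ones
(`per_closedBall_eq_mul_perimeter`).  Also `freeArea_eq_mul` (the `B̄(0,ρ)` free area is `ρ·Y_f`) and
`freeArea_nonneg`.
WHAT THIS IS NOT: the wall half of the move, nor a rung; F-C1 not moved.
-/

noncomputable section

namespace Summit.Ventures.Crystal3D.Theorems

open MeasureTheory Set Metric
open scoped RealInnerProductSpace ENNReal Pointwise
open Summit.Ventures.Crystal3D.Cruxes.TextureLiminf.TexShadow
open Literature.Analysis.Convexity
open Literature.MathematicalPhysics.StatisticalMechanics (perimeter)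

/-- The free `B̄(0,ρ)`-energy of a grain is `ρ` times its free Euclidean area (`ρ > 0`). -/
theorem freeArea_eq_mul {n : ℕ} (G : Fin n → Set E3) {ρ : ℝ} (hρ : 0 < ρ) (f : Fin n) :
    per (closedBall (0 : E3) ρ) (G f) - ∑ g, (if f = g then 0 else
      (per (closedBall (0 : E3) ρ) (G f) + per (closedBall (0 : E3) ρ) (G g) -
        per (closedBall (0 : E3) ρ) (G f ∪ G g)) / 2) =
    ρ * (per (closedBall (0 : E3) 1) (G f) - ∑ g, (if f = g then 0 else
      (per (closedBall (0 : E3) 1) (G f) + per (closedBall (0 : E3) 1) (G g) -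
        per (closedBall (0 : E3) 1) (G f ∪ G g)) / 2)) := by
  simp only [per_closedBall_eq_mul_perimeter hρ, per_closedBall_eq_mul_perimeter one_pos, one_mul]
  rw [mul_sub, Finset.mul_sum]
  congr 1
  refine Finset.sum_congr rfl fun g _ => ?_
  split_ifs <;> ring

/-- The free Euclidean area of a polyhedral grain is nonnegative (it is half a cross sum with the
exterior cells). -/
theorem freeArea_nonneg {n : ℕ} (G : Fin n → Set E3)
    (hPoly : ∀ f, ∃ (k : ℕ) (H : Fin k → Finset (E3 × ℝ)), G f = ⋃ i, polytope (H i))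
    (hvol : ∀ f, volume (G f) < ⊤) (hdisjG : ∀ f g, f ≠ g → Disjoint (G f) (G g)) (f : Fin n) :
    0 ≤ per (closedBall (0 : E3) 1) (G f) - ∑ g, (if f = g then 0 else
      (per (closedBall (0 : E3) 1) (G f) + per (closedBall (0 : E3) 1) (G g) -
        per (closedBall (0 : E3) 1) (G f ∪ G g)) / 2) := by
  obtain ⟨k, H, ν, S, SX, -, hext, -⟩ := exists_exterior_crossSums G hPoly hvol hdisjG
  set B : Set E3 := closedBall (0 : E3) 1 with hB
  have hBc : IsCompact B := isCompact_closedBall 0 1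
  have hBv : Convex ℝ B := convex_closedBall 0 1
  have hB0 : (0 : E3) ∈ B := mem_closedBall_self zero_le_one
  have hBs : -B = B := by rw [hB, neg_closedBall, neg_zero]
  have h := hext B hBc hBv hB0 hBs f
  rw [sum_ite_eq_sum_erase_div_two]
  have hnn := crossSum_nonneg hBc hB0 H ν (S f) SX
  linarith

/-- **Changing bodies costs at most `(R − r)` times the free area of the changed grains.**  For
pairwise disjoint polyhedral grains of finite volume and two families of origin-symmetric compact
convex bodies `K_f ⊇ B̄(0, r)`, `K'_f ⊆ B̄(0, R)` (`0 < r`, `0 < R`) with `K'_f = K_f` off `T`: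
`Fr(K') − (R − r)·Σ_{f ∈ T} Y_f ≤ Fr(K)`. -/
theorem freeEnergy_bodyChange_ge {n : ℕ} (G : Fin n → Set E3)
    (hPoly : ∀ f, ∃ (k : ℕ) (H : Fin k → Finset (E3 × ℝ)), G f = ⋃ i, polytope (H i))
    (hvol : ∀ f, volume (G f) < ⊤) (hdisjG : ∀ f g, f ≠ g → Disjoint (G f) (G g))
    (Kf : Fin n → Set E3) (hKc : ∀ f, IsCompact (Kf f)) (hKv : ∀ f, Convex ℝ (Kf f))
    (hK0 : ∀ f, (0 : E3) ∈ Kf f) (hKs : ∀ f, -Kf f = Kf f)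
    (Kf' : Fin n → Set E3) (hKc' : ∀ f, IsCompact (Kf' f)) (hKv' : ∀ f, Convex ℝ (Kf' f))
    (hK0' : ∀ f, (0 : E3) ∈ Kf' f) (hKs' : ∀ f, -Kf' f = Kf' f)
    {r R : ℝ} (hr : 0 < r) (hR : 0 < R) (hball : ∀ f, closedBall (0 : E3) r ⊆ Kf f)
    (hball' : ∀ f, Kf' f ⊆ closedBall (0 : E3) R) (T : Finset (Fin n))
    (hT : ∀ f, f ∉ T → Kf' f = Kf f) :
    (∑ f, (per (Kf' f) (G f) - ∑ g, (if f = g then 0 else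
        (per (Kf' f) (G f) + per (Kf' f) (G g) - per (Kf' f) (G f ∪ G g)) / 2))) -
      (R - r) * ∑ f ∈ T, (per (closedBall (0 : E3) 1) (G f) - ∑ g, (if f = g then 0 else
        (per (closedBall (0 : E3) 1) (G f) + per (closedBall (0 : E3) 1) (G g) -
          per (closedBall (0 : E3) 1) (G f ∪ G g)) / 2)) ≤
      ∑ f, (per (Kf f) (G f) - ∑ g, (if f = g then 0 else
        (per (Kf f) (G f) + per (Kf f) (G g) - per (Kf f) (G f ∪ G g)) / 2)) := by
  classical
  obtain ⟨k, H, ν, S, SX, -, hext, -⟩ := exists_exterior_crossSums G hPoly hvol hdisjG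
  set X : Set E3 → Fin k → Fin k → ℝ := fun K a b =>
    (if a < b then (supportFn K (ν a b) + supportFn K (-ν a b)) *
        facetArea (closure (polytope (H a)) ∩ closure (polytope (H b))) (ν a b)
      else (supportFn K (ν b a) + supportFn K (-ν b a)) *
        facetArea (closure (polytope (H b)) ∩ closure (polytope (H a))) (ν b a)) with hX
  -- each grain: free energy = half the cross sum with the exterior cells, for any admissible body
  have hf : ∀ (K : Set E3), IsCompact K → Convex ℝ K → (0 : E3) ∈ K → -K = K → ∀ f,
      per K (G f) - ∑ g, (if f = g then 0 else
        (per K (G f) + per K (G g) - per K (G f ∪ G g)) / 2) =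
      (∑ a ∈ S f, ∑ b ∈ SX, X K a b) / 2 := by
    intro K hK hKv0 hK00 hKs0 f
    have h : 2 * per K (G f) = (∑ g ∈ Finset.univ.erase f,
        (per K (G f) + per K (G g) - per K (G f ∪ G g))) +
        ∑ a ∈ S f, ∑ b ∈ SX, X K a b := hext K hK hKv0 hK00 hKs0 f
    rw [sum_ite_eq_sum_erase_div_two]
    linarith
  -- balls
  have hBc : ∀ ρ : ℝ, IsCompact (closedBall (0 : E3) ρ) := fun ρ => isCompact_closedBall 0 ρ
  have hBv : ∀ ρ : ℝ, Convex ℝ (closedBall (0 : E3) ρ) := fun ρ => convex_closedBall 0 ρ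
  have hB0 : ∀ {ρ : ℝ}, 0 < ρ → (0 : E3) ∈ closedBall (0 : E3) ρ := fun hρ => mem_closedBall_self hρ.le
  have hBs : ∀ ρ : ℝ, -closedBall (0 : E3) ρ = closedBall 0 ρ := fun ρ => by rw [neg_closedBall, neg_zero]
  -- abbreviations
  set FrK : Set E3 → Fin n → ℝ := fun K f => per K (G f) - ∑ g, (if f = g then 0 else
      (per K (G f) + per K (G g) - per K (G f ∪ G g)) / 2) with hFrK
  have hY1 : ∀ f, FrK (closedBall 0 1) f = (∑ a ∈ S f, ∑ b ∈ SX, X (closedBall 0 1) a b) / 2 :=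
    fun f => hf _ (hBc 1) (hBv 1) (hB0 one_pos) (hBs 1) f
  -- per-grain comparison
  have hgrain : ∀ f, FrK (Kf' f) f - (if f ∈ T then (R - r) * FrK (closedBall 0 1) f else 0) ≤
      FrK (Kf f) f := by
    intro f
    by_cases hfT : f ∈ T
    · rw [if_pos hfT]
      -- lower bound for the old body, upper bound for the new one
      have hlow : (∑ a ∈ S f, ∑ b ∈ SX, X (closedBall 0 r) a b) ≤ ∑ a ∈ S f, ∑ b ∈ SX, X (Kf f) a b :=
        crossSum_mono (hball f) (hKc f).isBounded ⟨0, hB0 hr⟩ H ν (S f) SX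
      have hup : (∑ a ∈ S f, ∑ b ∈ SX, X (Kf' f) a b) ≤ ∑ a ∈ S f, ∑ b ∈ SX, X (closedBall 0 R) a b :=
        crossSum_mono (hball' f) isBounded_closedBall ⟨0, hK0' f⟩ H ν (S f) SX
      have er : FrK (closedBall 0 r) f = r * FrK (closedBall 0 1) f := freeArea_eq_mul G hr f
      have eR : FrK (closedBall 0 R) f = R * FrK (closedBall 0 1) f := freeArea_eq_mul G hR f
      simp only [hFrK] at er eR ⊢
      rw [hf _ (hBc r) (hBv r) (hB0 hr) (hBs r) f, hf _ (hBc 1) (hBv 1) (hB0 one_pos) (hBs 1) f] at er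
      rw [hf _ (hBc R) (hBv R) (hB0 hR) (hBs R) f, hf _ (hBc 1) (hBv 1) (hB0 one_pos) (hBs 1) f] at eR
      rw [hf _ (hKc' f) (hKv' f) (hK0' f) (hKs' f) f, hf _ (hKc f) (hKv f) (hK0 f) (hKs f) f,
        hf _ (hBc 1) (hBv 1) (hB0 one_pos) (hBs 1) f]
      nlinarith
    · simp only [hFrK]
      rw [if_neg hfT, hT f hfT, sub_zero]
  have hsum := Finset.sum_le_sum fun f (_ : f ∈ Finset.univ) => hgrain f
  rw [Finset.sum_sub_distrib, ← Finset.sum_filter, Finset.filter_mem_eq_inter, Finset.univ_inter,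
    ← Finset.mul_sum] at hsum
  exact hsum

end Summit.Ventures.Crystal3D.Theorems

end
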